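import Literature.NumberTheory.EllipticCurves.Curve5077aRank
import Literature.NumberTheory.EllipticCurves.PointCountEulerCriterion
import Literature.NumberTheory.EllipticCurves.ModularityVersionAp
import Literature.NumberTheory.Automorphic.LangWave0Proofs
import HarnessLib

/-!
# The curve 5077a: point counts `#Ẽ(𝔽_p)` and `a_p(E)` for the primes `p ≤ 61`

For `E = Curve5077a.E : y² + y = x³ − 7x + 6` (conductor `5077`, prime; Buhler–Gross–Zagier 1985)
this file computes `a_p(E) = p + 1 − #Ẽ(𝔽_p)` for every prime `p ≤ 61` as closed integer
equalities `Curve5077a.LFunction_E_p : E.LFunction p = a_p` about Mathlib's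
`WeierstrassCurve.LFunction`: the reduction at `p ≠ 5077` is good (`Δ = 5077`), so the tree theorem
`Literature.NumberTheory.Automorphic.lFunction_map_apply_prime_of_not_dvd` (Silverman *AEC*
Ex. 8.19(a)) applies to the integral model `[0,0,1,−7,6]`, and the point count is decided by the
kernel column by column through Euler's criterion (`card_sol_eq_sum_euler`,
`PointCountEulerCriterion.lean`). BGZ p. 478: the `a_p` «can be computed rapidly by counting points
on `E (mod p)`»; the values are Cremona's (Table 3, 5077a:
`−2, −3, −4, −4, −6, −4, −4, −7, −6, −6, −2, 0, 0, −8, −9, −9, −11, −2`). Companion file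
`Curve5077aCoefficients.lean` extends this to all `n ≤ 64`. Everything is PROVED; no `def`.

## References
* J. P. Buhler, B. H. Gross, D. B. Zagier, *On the conjecture of Birch and Swinnerton-Dyer for an
  elliptic curve of rank 3*, Math. Comp. 44 (1985) 473–481, §3 (p. 478). [BuhlerGrossZagier1985]
* J. E. Cremona, *Algorithms for Modular Elliptic Curves*, 2nd ed. (1997), Table 3 (curve 5077a).
  [CremonaAlgorithms1997]
* J. H. Silverman, *The Arithmetic of Elliptic Curves*, 2nd ed. (2009), Ex. 8.19(a). [SilvermanAEC2009]
-/

namespace Literature.NumberTheory.EllipticCurves.Curve5077a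

open WeierstrassCurve Literature.NumberTheory.Automorphic

/-- `E` is the base change to `ℚ` of the integral Weierstrass model `[0, 0, 1, −7, 6]` (a literal; no
new definition). [cite: BuhlerGrossZagier1985, §1 eq. (2)] -/
theorem E_eq_map_EZ : E = (⟨0, 0, 1, -7, 6⟩ : WeierstrassCurve ℤ).map (Int.castRingHom ℚ) := by
  ext <;> simp [E, WeierstrassCurve.map]

/-- `Δ([0,0,1,−7,6]) = 5077` over `ℤ`. [cite: BuhlerGrossZagier1985, §1 eq. (2)] -/
theorem EZ_Δ : (⟨0, 0, 1, -7, 6⟩ : WeierstrassCurve ℤ).Δ = 5077 := by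
  norm_num [WeierstrassCurve.Δ, WeierstrassCurve.b₂, WeierstrassCurve.b₄, WeierstrassCurve.b₆,
    WeierstrassCurve.b₈]

/-- **`a_p(E) = p + 1 − #Ẽ(𝔽_p)`** for every prime `p ≠ 5077` (good reduction since `Δ = 5077`;
Silverman *AEC* Ex. 8.19(a) via the tree's `lFunction_map_apply_prime_of_not_dvd`).
[cite: SilvermanAEC2009, Exercise 8.19(a)] -/
theorem LFunction_E_prime {p : ℕ} (hp : p.Prime) (hp' : p ≠ 5077) :
    E.LFunction p = (p : ℤ) + 1 - (numPointsMod ⟨0, 0, 1, -7, 6⟩ p : ℤ) := by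
  rw [E_eq_map_EZ, lFunction_map_apply_prime_of_not_dvd _ hp ?_]
  · rfl
  · rw [EZ_Δ]
    intro h
    have h' : p ∣ 5077 := by exact_mod_cast h
    exact hp' ((Nat.prime_dvd_prime_iff_eq hp (by norm_num)).mp h')

/-- `a₁(E) = 1` (the Dirichlet series of `L(E,s)` is normalised, Diamond–Shurman (8.44): `a_1 = 1`). [cite: DiamondShurman2005, §8.8 (8.44)] -/
theorem LFunction_E_1 : E.LFunction 1 = 1 := E.isMultiplicative_LFunction.map_one

/-- `#Ẽ(𝔽₂) = 5` for `5077a`, i.e. `a₂ = -2` (kernel enumeration). [cite: BuhlerGrossZagier1985, §3 p. 478] -/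
theorem numPointsMod_E_2 : numPointsMod ⟨0, 0, 1, -7, 6⟩ 2 = 5 := by
  unfold numPointsMod
  rw [@WeierstrassCurve.natCard_point_eq_one_add_card (ZMod 2) (@ZMod.instField 2 ⟨by norm_num⟩) _ _ _
    (by decide +kernel)]
  decide +kernel
/-- `a_2(5077a) = -2`. [cite: CremonaAlgorithms1997, Table 3 (5077a)] -/
theorem LFunction_E_2 : E.LFunction 2 = -2 := by
  rw [LFunction_E_prime (by norm_num) (by norm_num), numPointsMod_E_2]; norm_num

/-- `#Ẽ(𝔽_3) = 7` for `5077a`, i.e. `a_3 = -3` (kernel, Euler's criterion). [cite: BuhlerGrossZagier1985, §3 p. 478] -/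
theorem numPointsMod_E_3 : numPointsMod ⟨0, 0, 1, -7, 6⟩ 3 = 7 := by
  unfold numPointsMod
  rw [@WeierstrassCurve.natCard_point_eq_one_add_card (ZMod 3) (@ZMod.instField 3 ⟨by norm_num⟩) _ _ _
    (by decide +kernel), @card_sol_eq_sum_euler (ZMod 3) (@ZMod.instField 3 ⟨by norm_num⟩) _ _
    (by rw [ZMod.ringChar_zmod_n]; decide), ZMod.card]
  decide +kernel
/-- `a_3(5077a) = -3`. [cite: CremonaAlgorithms1997, Table 3 (5077a)] -/
theorem LFunction_E_3 : E.LFunction 3 = -3 := by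
  rw [LFunction_E_prime (by norm_num) (by norm_num), numPointsMod_E_3]; norm_num

/-- `#Ẽ(𝔽_5) = 10` for `5077a`, i.e. `a_5 = -4` (kernel, Euler's criterion). [cite: BuhlerGrossZagier1985, §3 p. 478] -/
theorem numPointsMod_E_5 : numPointsMod ⟨0, 0, 1, -7, 6⟩ 5 = 10 := by
  unfold numPointsMod
  rw [@WeierstrassCurve.natCard_point_eq_one_add_card (ZMod 5) (@ZMod.instField 5 ⟨by norm_num⟩) _ _ _
    (by decide +kernel), @card_sol_eq_sum_euler (ZMod 5) (@ZMod.instField 5 ⟨by norm_num⟩) _ _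
    (by rw [ZMod.ringChar_zmod_n]; decide), ZMod.card]
  decide +kernel
/-- `a_5(5077a) = -4`. [cite: CremonaAlgorithms1997, Table 3 (5077a)] -/
theorem LFunction_E_5 : E.LFunction 5 = -4 := by
  rw [LFunction_E_prime (by norm_num) (by norm_num), numPointsMod_E_5]; norm_num

/-- `#Ẽ(𝔽_7) = 12` for `5077a`, i.e. `a_7 = -4` (kernel, Euler's criterion). [cite: BuhlerGrossZagier1985, §3 p. 478] -/
theorem numPointsMod_E_7 : numPointsMod ⟨0, 0, 1, -7, 6⟩ 7 = 12 := by
  unfold numPointsMod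
  rw [@WeierstrassCurve.natCard_point_eq_one_add_card (ZMod 7) (@ZMod.instField 7 ⟨by norm_num⟩) _ _ _
    (by decide +kernel), @card_sol_eq_sum_euler (ZMod 7) (@ZMod.instField 7 ⟨by norm_num⟩) _ _
    (by rw [ZMod.ringChar_zmod_n]; decide), ZMod.card]
  decide +kernel
/-- `a_7(5077a) = -4`. [cite: CremonaAlgorithms1997, Table 3 (5077a)] -/
theorem LFunction_E_7 : E.LFunction 7 = -4 := by
  rw [LFunction_E_prime (by norm_num) (by norm_num), numPointsMod_E_7]; norm_num

/-- `#Ẽ(𝔽_11) = 18` for `5077a`, i.e. `a_11 = -6` (kernel, Euler's criterion). [cite: BuhlerGrossZagier1985, §3 p. 478] -/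
theorem numPointsMod_E_11 : numPointsMod ⟨0, 0, 1, -7, 6⟩ 11 = 18 := by
  unfold numPointsMod
  rw [@WeierstrassCurve.natCard_point_eq_one_add_card (ZMod 11) (@ZMod.instField 11 ⟨by norm_num⟩) _ _ _
    (by decide +kernel), @card_sol_eq_sum_euler (ZMod 11) (@ZMod.instField 11 ⟨by norm_num⟩) _ _
    (by rw [ZMod.ringChar_zmod_n]; decide), ZMod.card]
  decide +kernel
/-- `a_11(5077a) = -6`. [cite: CremonaAlgorithms1997, Table 3 (5077a)] -/
theorem LFunction_E_11 : E.LFunction 11 = -6 := by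
  rw [LFunction_E_prime (by norm_num) (by norm_num), numPointsMod_E_11]; norm_num

/-- `#Ẽ(𝔽_13) = 18` for `5077a`, i.e. `a_13 = -4` (kernel, Euler's criterion). [cite: BuhlerGrossZagier1985, §3 p. 478] -/
theorem numPointsMod_E_13 : numPointsMod ⟨0, 0, 1, -7, 6⟩ 13 = 18 := by
  unfold numPointsMod
  rw [@WeierstrassCurve.natCard_point_eq_one_add_card (ZMod 13) (@ZMod.instField 13 ⟨by norm_num⟩) _ _ _
    (by decide +kernel), @card_sol_eq_sum_euler (ZMod 13) (@ZMod.instField 13 ⟨by norm_num⟩) _ _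
    (by rw [ZMod.ringChar_zmod_n]; decide), ZMod.card]
  decide +kernel
/-- `a_13(5077a) = -4`. [cite: CremonaAlgorithms1997, Table 3 (5077a)] -/
theorem LFunction_E_13 : E.LFunction 13 = -4 := by
  rw [LFunction_E_prime (by norm_num) (by norm_num), numPointsMod_E_13]; norm_num

/-- `#Ẽ(𝔽_17) = 22` for `5077a`, i.e. `a_17 = -4` (kernel, Euler's criterion). [cite: BuhlerGrossZagier1985, §3 p. 478] -/
theorem numPointsMod_E_17 : numPointsMod ⟨0, 0, 1, -7, 6⟩ 17 = 22 := by
  unfold numPointsMod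
  rw [@WeierstrassCurve.natCard_point_eq_one_add_card (ZMod 17) (@ZMod.instField 17 ⟨by norm_num⟩) _ _ _
    (by decide +kernel), @card_sol_eq_sum_euler (ZMod 17) (@ZMod.instField 17 ⟨by norm_num⟩) _ _
    (by rw [ZMod.ringChar_zmod_n]; decide), ZMod.card]
  decide +kernel
/-- `a_17(5077a) = -4`. [cite: CremonaAlgorithms1997, Table 3 (5077a)] -/
theorem LFunction_E_17 : E.LFunction 17 = -4 := by
  rw [LFunction_E_prime (by norm_num) (by norm_num), numPointsMod_E_17]; norm_num

/-- `#Ẽ(𝔽_19) = 27` for `5077a`, i.e. `a_19 = -7` (kernel, Euler's criterion). [cite: BuhlerGrossZagier1985, §3 p. 478] -/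
theorem numPointsMod_E_19 : numPointsMod ⟨0, 0, 1, -7, 6⟩ 19 = 27 := by
  unfold numPointsMod
  rw [@WeierstrassCurve.natCard_point_eq_one_add_card (ZMod 19) (@ZMod.instField 19 ⟨by norm_num⟩) _ _ _
    (by decide +kernel), @card_sol_eq_sum_euler (ZMod 19) (@ZMod.instField 19 ⟨by norm_num⟩) _ _
    (by rw [ZMod.ringChar_zmod_n]; decide), ZMod.card]
  decide +kernel
/-- `a_19(5077a) = -7`. [cite: CremonaAlgorithms1997, Table 3 (5077a)] -/
theorem LFunction_E_19 : E.LFunction 19 = -7 := by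
  rw [LFunction_E_prime (by norm_num) (by norm_num), numPointsMod_E_19]; norm_num

/-- `#Ẽ(𝔽_23) = 30` for `5077a`, i.e. `a_23 = -6` (kernel, Euler's criterion). [cite: BuhlerGrossZagier1985, §3 p. 478] -/
theorem numPointsMod_E_23 : numPointsMod ⟨0, 0, 1, -7, 6⟩ 23 = 30 := by
  unfold numPointsMod
  rw [@WeierstrassCurve.natCard_point_eq_one_add_card (ZMod 23) (@ZMod.instField 23 ⟨by norm_num⟩) _ _ _
    (by decide +kernel), @card_sol_eq_sum_euler (ZMod 23) (@ZMod.instField 23 ⟨by norm_num⟩) _ _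
    (by rw [ZMod.ringChar_zmod_n]; decide), ZMod.card]
  decide +kernel
/-- `a_23(5077a) = -6`. [cite: CremonaAlgorithms1997, Table 3 (5077a)] -/
theorem LFunction_E_23 : E.LFunction 23 = -6 := by
  rw [LFunction_E_prime (by norm_num) (by norm_num), numPointsMod_E_23]; norm_num

/-- `#Ẽ(𝔽_29) = 36` for `5077a`, i.e. `a_29 = -6` (kernel, Euler's criterion). [cite: BuhlerGrossZagier1985, §3 p. 478] -/
theorem numPointsMod_E_29 : numPointsMod ⟨0, 0, 1, -7, 6⟩ 29 = 36 := by
  unfold numPointsMod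
  rw [@WeierstrassCurve.natCard_point_eq_one_add_card (ZMod 29) (@ZMod.instField 29 ⟨by norm_num⟩) _ _ _
    (by decide +kernel), @card_sol_eq_sum_euler (ZMod 29) (@ZMod.instField 29 ⟨by norm_num⟩) _ _
    (by rw [ZMod.ringChar_zmod_n]; decide), ZMod.card]
  decide +kernel
/-- `a_29(5077a) = -6`. [cite: CremonaAlgorithms1997, Table 3 (5077a)] -/
theorem LFunction_E_29 : E.LFunction 29 = -6 := by
  rw [LFunction_E_prime (by norm_num) (by norm_num), numPointsMod_E_29]; norm_num

/-- `#Ẽ(𝔽_31) = 34` for `5077a`, i.e. `a_31 = -2` (kernel, Euler's criterion). [cite: BuhlerGrossZagier1985, §3 p. 478] -/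
theorem numPointsMod_E_31 : numPointsMod ⟨0, 0, 1, -7, 6⟩ 31 = 34 := by
  unfold numPointsMod
  rw [@WeierstrassCurve.natCard_point_eq_one_add_card (ZMod 31) (@ZMod.instField 31 ⟨by norm_num⟩) _ _ _
    (by decide +kernel), @card_sol_eq_sum_euler (ZMod 31) (@ZMod.instField 31 ⟨by norm_num⟩) _ _
    (by rw [ZMod.ringChar_zmod_n]; decide), ZMod.card]
  decide +kernel
/-- `a_31(5077a) = -2`. [cite: CremonaAlgorithms1997, Table 3 (5077a)] -/
theorem LFunction_E_31 : E.LFunction 31 = -2 := by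
  rw [LFunction_E_prime (by norm_num) (by norm_num), numPointsMod_E_31]; norm_num

/-- `#Ẽ(𝔽_37) = 38` for `5077a`, i.e. `a_37 = 0` (kernel, Euler's criterion). [cite: BuhlerGrossZagier1985, §3 p. 478] -/
theorem numPointsMod_E_37 : numPointsMod ⟨0, 0, 1, -7, 6⟩ 37 = 38 := by
  unfold numPointsMod
  rw [@WeierstrassCurve.natCard_point_eq_one_add_card (ZMod 37) (@ZMod.instField 37 ⟨by norm_num⟩) _ _ _
    (by decide +kernel), @card_sol_eq_sum_euler (ZMod 37) (@ZMod.instField 37 ⟨by norm_num⟩) _ _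
    (by rw [ZMod.ringChar_zmod_n]; decide), ZMod.card]
  decide +kernel
/-- `a_37(5077a) = 0`. [cite: CremonaAlgorithms1997, Table 3 (5077a)] -/
theorem LFunction_E_37 : E.LFunction 37 = 0 := by
  rw [LFunction_E_prime (by norm_num) (by norm_num), numPointsMod_E_37]; norm_num

/-- `#Ẽ(𝔽_41) = 42` for `5077a`, i.e. `a_41 = 0` (kernel, Euler's criterion). [cite: BuhlerGrossZagier1985, §3 p. 478] -/
theorem numPointsMod_E_41 : numPointsMod ⟨0, 0, 1, -7, 6⟩ 41 = 42 := by
  unfold numPointsMod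
  rw [@WeierstrassCurve.natCard_point_eq_one_add_card (ZMod 41) (@ZMod.instField 41 ⟨by norm_num⟩) _ _ _
    (by decide +kernel), @card_sol_eq_sum_euler (ZMod 41) (@ZMod.instField 41 ⟨by norm_num⟩) _ _
    (by rw [ZMod.ringChar_zmod_n]; decide), ZMod.card]
  decide +kernel
/-- `a_41(5077a) = 0`. [cite: CremonaAlgorithms1997, Table 3 (5077a)] -/
theorem LFunction_E_41 : E.LFunction 41 = 0 := by
  rw [LFunction_E_prime (by norm_num) (by norm_num), numPointsMod_E_41]; norm_num

/-- `#Ẽ(𝔽_43) = 52` for `5077a`, i.e. `a_43 = -8` (kernel, Euler's criterion). [cite: BuhlerGrossZagier1985, §3 p. 478] -/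
theorem numPointsMod_E_43 : numPointsMod ⟨0, 0, 1, -7, 6⟩ 43 = 52 := by
  unfold numPointsMod
  rw [@WeierstrassCurve.natCard_point_eq_one_add_card (ZMod 43) (@ZMod.instField 43 ⟨by norm_num⟩) _ _ _
    (by decide +kernel), @card_sol_eq_sum_euler (ZMod 43) (@ZMod.instField 43 ⟨by norm_num⟩) _ _
    (by rw [ZMod.ringChar_zmod_n]; decide), ZMod.card]
  decide +kernel
/-- `a_43(5077a) = -8`. [cite: CremonaAlgorithms1997, Table 3 (5077a)] -/
theorem LFunction_E_43 : E.LFunction 43 = -8 := by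
  rw [LFunction_E_prime (by norm_num) (by norm_num), numPointsMod_E_43]; norm_num

/-- `#Ẽ(𝔽_47) = 57` for `5077a`, i.e. `a_47 = -9` (kernel, Euler's criterion). [cite: BuhlerGrossZagier1985, §3 p. 478] -/
theorem numPointsMod_E_47 : numPointsMod ⟨0, 0, 1, -7, 6⟩ 47 = 57 := by
  unfold numPointsMod
  rw [@WeierstrassCurve.natCard_point_eq_one_add_card (ZMod 47) (@ZMod.instField 47 ⟨by norm_num⟩) _ _ _
    (by decide +kernel), @card_sol_eq_sum_euler (ZMod 47) (@ZMod.instField 47 ⟨by norm_num⟩) _ _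
    (by rw [ZMod.ringChar_zmod_n]; decide), ZMod.card]
  decide +kernel
/-- `a_47(5077a) = -9`. [cite: CremonaAlgorithms1997, Table 3 (5077a)] -/
theorem LFunction_E_47 : E.LFunction 47 = -9 := by
  rw [LFunction_E_prime (by norm_num) (by norm_num), numPointsMod_E_47]; norm_num

/-- `#Ẽ(𝔽_53) = 63` for `5077a`, i.e. `a_53 = -9` (kernel, Euler's criterion). [cite: BuhlerGrossZagier1985, §3 p. 478] -/
theorem numPointsMod_E_53 : numPointsMod ⟨0, 0, 1, -7, 6⟩ 53 = 63 := by
  unfold numPointsMod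
  rw [@WeierstrassCurve.natCard_point_eq_one_add_card (ZMod 53) (@ZMod.instField 53 ⟨by norm_num⟩) _ _ _
    (by decide +kernel), @card_sol_eq_sum_euler (ZMod 53) (@ZMod.instField 53 ⟨by norm_num⟩) _ _
    (by rw [ZMod.ringChar_zmod_n]; decide), ZMod.card]
  decide +kernel
/-- `a_53(5077a) = -9`. [cite: CremonaAlgorithms1997, Table 3 (5077a)] -/
theorem LFunction_E_53 : E.LFunction 53 = -9 := by
  rw [LFunction_E_prime (by norm_num) (by norm_num), numPointsMod_E_53]; norm_num

/-- `#Ẽ(𝔽_59) = 71` for `5077a`, i.e. `a_59 = -11` (kernel, Euler's criterion). [cite: BuhlerGrossZagier1985, §3 p. 478] -/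
theorem numPointsMod_E_59 : numPointsMod ⟨0, 0, 1, -7, 6⟩ 59 = 71 := by
  unfold numPointsMod
  rw [@WeierstrassCurve.natCard_point_eq_one_add_card (ZMod 59) (@ZMod.instField 59 ⟨by norm_num⟩) _ _ _
    (by decide +kernel), @card_sol_eq_sum_euler (ZMod 59) (@ZMod.instField 59 ⟨by norm_num⟩) _ _
    (by rw [ZMod.ringChar_zmod_n]; decide), ZMod.card]
  decide +kernel
/-- `a_59(5077a) = -11`. [cite: CremonaAlgorithms1997, Table 3 (5077a)] -/
theorem LFunction_E_59 : E.LFunction 59 = -11 := by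
  rw [LFunction_E_prime (by norm_num) (by norm_num), numPointsMod_E_59]; norm_num

/-- `#Ẽ(𝔽_61) = 64` for `5077a`, i.e. `a_61 = -2` (kernel, Euler's criterion). [cite: BuhlerGrossZagier1985, §3 p. 478] -/
theorem numPointsMod_E_61 : numPointsMod ⟨0, 0, 1, -7, 6⟩ 61 = 64 := by
  unfold numPointsMod
  rw [@WeierstrassCurve.natCard_point_eq_one_add_card (ZMod 61) (@ZMod.instField 61 ⟨by norm_num⟩) _ _ _
    (by decide +kernel), @card_sol_eq_sum_euler (ZMod 61) (@ZMod.instField 61 ⟨by norm_num⟩) _ _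
    (by rw [ZMod.ringChar_zmod_n]; decide), ZMod.card]
  decide +kernel
/-- `a_61(5077a) = -2`. [cite: CremonaAlgorithms1997, Table 3 (5077a)] -/
theorem LFunction_E_61 : E.LFunction 61 = -2 := by
  rw [LFunction_E_prime (by norm_num) (by norm_num), numPointsMod_E_61]; norm_num

end Literature.NumberTheory.EllipticCurves.Curve5077a
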